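import Literature.NumberTheory.LFunctions.WeilFinitePrimeQuadratic
import Literature.NumberTheory.LFunctions.YoshidaWindowSpaces
import Literature.NumberTheory.LFunctions.ConnesProlateGuess
import HarnessLib

/-!
# The semi-local Weil quadratic form on `L²([λ⁻¹, λ], d*u)`: core, relaxation, finite sections,
# and the prolate projection `Π(λ,k)` (Connes–Consani, *Spectral triples and ζ-cycles*, §2.1.2–§2.5, §3)

RH-FREE corpus literature (label, line 1): this file types statements of A. Connes, C. Consani,
*Spectral triples and ζ-cycles*, Enseign. Math. **69** (2023) 93–148, doi:10.4171/lem/1049 =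
arXiv:2106.01715 [cite: ConnesConsani2023, §2.1.2 Lemma 2.2, Prop. 2.3, Cor. 2.4; §3 Def. 3.1], about the
functional analysis of the semi-local Weil quadratic form `QW_λ` on ONE window and about a finite-rank
projection built from prolate spheroidal wave functions.  Nothing here is a positivity statement, nothing
here bears on the truth of the Riemann hypothesis, and no declaration is worded as progress toward it.
Locators `pNNNN:Lnn` are chunk:line of the held arXiv text (`paper:arxiv-2106.01715`); journal pages and
equation numbers are read from the journal page images (cell file `cc/src/ConnesConsani2023_EM69_pages`):
Prop. 2.1 and (2.11) p. 103; Lemma 2.2, (2.13)–(2.15) p. 104; (2.16)–(2.18) p. 105; (2.19), Prop. 2.3 with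
(2.20), Cor. 2.4 p. 106; §2.1.3 p. 107; §3: (3.1)–(3.2) p. 118, (3.3) p. 119, the `φ_n`, (3.4) and Def. 3.1
p. 120, (3.5) p. 121.

## Dictionary (the tree's additive normalisation; cite, never restate)

The paper works multiplicatively on `[λ⁻¹, λ] ⊂ ℝ₊^*` with `d*u = du/u`, `λ > 1`, `L = 2 log λ`; the tree
works additively (`x = log u`) on the window `[−a, a]`, **`a = log λ = L/2`**, with test functions
`IsWeilTest g`, `tsupport g ⊆ Icc (-a) a` (`WeilExplicit.lean`).  Under this change of variable:

* `QW_λ(f, f)` on `C_c^∞` test functions ↦ `weilQuadratic g` (README dictionary of the cell), and the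
  printed formula of **Prop. 2.1** (p0006:L55; p. 103), `QW_λ(f,f) = ∫ |f̂(t)|² 2∂_tθ(t) dt/2π
  + 2 Re(f̂(i/2) conj f̂(−i/2)) − Σ_{1<n≤λ²} Λ(n) ⟨f | V(n) f⟩`, is the PROVED
  `weilQuadratic_eq_weilFinitePrimeQuadratic` (`WeilFinitePrimeQuadratic.lean`: `Q(g) = E_N(g)`,
  `E_N(g) = 2 Re(ĝ(0) conj ĝ(1)) − (log π)‖g‖₂² + (1/2π)∫ |ĝ(1/2+it)|² (Re ψ(1/4+it/2) − ρ_N(t)) dt`,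
  `2θ'(t) = Re ψ(1/4 + it/2) − log π`, `N = ⌊λ²⌋`), with the polar term's rank-two mechanism
  `SemilocalTrigBasis.polar_convolution` (`WeilPolarTrigBasis.lean`).  Prop. 2.1 is CITED, not restated;
  only its `L²`-extension clause (lower bounded, lower semicontinuous) is typed below (`prop_2_1`).
* `f̂(t) = ∫ f(u) u^{-it} d*u` ↦ `weilMellin g (1/2 + t I) = ∫ g(x) e^{itx} dx` (opposite sign of `t`;
  every weight below is even in `t`, so nothing depends on the sign).
* `U(u) = u^{iπ/log λ}` (Lemma 2.2), i.e. `U(x) = exp(2πix/L) = exp(πix/a)` ↦ Yoshida's `χ_1` up to the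
  factor `(2a)^{-1/2}`: `Yoshida1992.chi a n` (`YoshidaWindowSpaces.lean`); the finite section
  **`E_N = span{U^k : |k| ≤ N}`** (Cor. 2.4; Lemma 2.6) ↦ **`Yoshida1992.W a N`**; the Laurent polynomials
  `ℂ[U, U⁻¹]` ↦ `⋃_N W a N` (`IsLaurentPolynomial`); the real orthonormal basis `ξ_n`, `η_n = ξ_n ∘ log` of
  §2.1.3 ↦ `SemilocalTrigBasis.xi` (`WeilPolarTrigBasis.lean`, `YoshidaWindowTrigBasis.lean`).
* **Lemma 2.5 = Lemma (polarize)** (p0008:L10, cited on p0005:L3 as "Lemma (polarize)"), Lemma 2.6 (ii)–(iii),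
  Lemma 2.7 and the splitting `QW_λ = QW_λ⁺ ⊕ QW_λ⁻` EXIST: `SemilocalTrigBasis.conv_xi_eq_intervalIntegral`,
  `conv_adj_neg`, `conv_adj_add_eq_zero_of_even_odd`, `conv_even_odd_symm_eq_zero`, `conv_even_table`,
  `conv_odd_table`, `lemma27_even` (with the kernel-checked ERRATUM `16` for the printed `8`), `lemma27_odd`
  (`WeilPolarTrigBasis.lean`); complex form `weilFunctional_weilConv_weilReflect_eq_zero_of_even_odd`,
  `weilQuadratic_add_of_even_odd`, `weilQuadratic_eq_evenPart_add_oddPart` (`WeilWindowSimpleEven.lean`).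
  Not restated here.
* The map `𝓔(f)(x) = x^{1/2} Σ_{n>0} f(nx)` of §3 eq. (3.1) (p0011:L5) EXISTS: `connesE`
  (`ConnesProlateGuess.lean`); the prolate spheroidal wave functions `ψ_{m,λ} = PS_{2m,0}(2πλ², x/λ)` of §3
  (p0011:L33) are, up to the normalising scalar, the tree's `h_{2m,λ}`: `IsProlateFunction lam (2*m)`
  (same operator `W_λ = −∂(λ² − q²)∂ + (2πλq)²`, p0011:L25 = CCM25 (7.5)); existence/uniqueness
  `existsUnique_isProlateFunction(_holds)`.  No second PSWF definition is introduced.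

## What is typed here (statements first; named facts are `def … : Prop`, D-0014)

* §1 `IsLaurentPolynomial a η` — `η ∈ ℂ[U,U⁻¹]`, i.e. `η ∈ W a N` for some `N`.
* §2 The `L²`-EXTENSION of `QW_λ` which Prop. 2.1 asserts to exist ("a lower bounded lower semi-continuous
  quadratic form `QW_λ : L²([λ⁻¹,λ], d*u) → (−∞, +∞]`"): `logSobolevEnergy ξ = ∫ |ξ̂(s)|²(1 + log(1+s²)) ds`
  (the norm `‖·‖₁²` of the proof of Lemma 2.2, unnumbered display p0007:L43) as a junk-free `ℝ≥0∞`
  lintegral; the form domain `formDomain a` (window-supported `L²` functions of finite energy — by the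
  printed asymptotics `∂_tθ(t) = ½ log|t| + O(1)` (p0007:L12) this is `Dom(QW_λ) = {Q_∞ < ∞}`); the extended
  form `semilocalWeilForm a ξ : EReal` (`= E_{⌊λ²⌋}(ξ)` on the domain, `= ⊤` off it); `prop_2_1` = the
  clause "lower bounded and lower semicontinuous on `L²`" (FACT; the formula itself is proved, see above).
* §3 **Lemma 2.2** (`lemma_2_2`, FACT): `ℂ[U,U⁻¹]` is a core — typed in the reduced form (2.16)
  (`quadratsemi3`, p0007:L24) to which the printed proof reduces it: density of `⋃_N E_N` in the form domain
  for `‖·‖₁`.  **Prop. 2.3** (`prop_2_3`, FACT): `QW_λ(f) = liminf_{g_n → f, g_n ∈ ℂ[U,U⁻¹]} QW_λ(g_n)`, typed as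
  the two clauses of a relaxation (lower limit inequality along every Laurent-polynomial sequence, and a
  recovery sequence).  **Cor. 2.4** (`cor_2_4`, FACT): the lower bound of `QW_λ` is `lim_N` of the smallest
  eigenvalue of `QW_λ|E_N` (`finiteSectionMin a N`, the minimum of the form on the unit sphere of `E_N`;
  `formLowerBound a`).
* §4 PROVED glue: test functions on the window lie in the form domain and the extended form IS
  `Re weilQuadratic` there (`semilocalWeilForm_eq_re_weilQuadratic`); on the domain the form is the
  finite-prime analytic form; `E_N ⊆ E_{N+1}`.
* §5 **Def. 3.1** (p0012:L26): the vectors `φ_n` (p0012:L11), the "prolate vectors" whose `η_j`-components are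
  the printed (3.4) (`componentsE`, p0012:L20) — `prolateVector` —, their truncations to `E_N`
  (`prolateVectorN`, "the obtained vectors in `E_N`"), the span and **`Π(λ,k)`** = the orthogonal projection
  on `span{ε_n : 2 ≤ n ≤ k+1}` (`prolateProjection`, written with the Gram matrix: Gram–Schmidt does not
  change the span), and the grading `γ` (p0012:L28) with the PROVED parity `γ ε_n = (−1)^n ε_n` at the level
  of the prolate vectors (`prolateVector_neg`), which is the content of (3.5) (`commugrad`, p0012:L30).

## What is deliberately NOT here

* Def. 1.1 = Def. 6.1 (ζ-cycle), the map `Σ_μ 𝓔`, Lemma 6.1 (label `fouriertruncated1`, the "Lemma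
  (fouriertruncated)" of the cell's assignment table) and Thm. 1.1 = Thm. 6.4 belong to §6 and are typed
  in `ZetaCycles.lean` (seat t11); §4–§5 (`Θ(λ,k)`, `D(λ,k)`) in `ZetaCyclesSpectralTriple.lean` (t10).
* §2.2–§2.5 (p0009:L82–p0010:L19) and the intro sentence "when `λ² = 11` the smallest positive eigenvalue is
  `2.389 × 10⁻⁴⁸`" (p0003:L20) report FLOATING-POINT computations on finite sections (`σ^±` truncated at
  `|n|,|m| ≤ N`, Figures `testeven`…`smallsmall1`); §2.5 contains no numbered or displayed statement
  ("one finds an exponential behaviour", "their number increases roughly like `μ = exp L`").  Per the cell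
  README §4 these are not typing targets and are NOT typed; `finiteSectionMin` is the exact object they
  approximate.
* No operator `A_λ`, no Kato representation theorem ([Simon] Thm. 2, p0006:L46), no spectral triple.
* Positivity of `QW_λ` for all `λ` is RH (tree: `riemannHypothesis_iff_forall_weilPositivityOn`); it is not
  stated here in any form.
-/

noncomputable section

open Complex Filter Set MeasureTheory
open scoped Real Topology ENNReal ComplexConjugate

namespace Literature.NumberTheory.ConnesConsani2023

open Literature.NumberTheory.LFunctions

/-! ## §1 Laurent polynomials `ℂ[U, U⁻¹]` on the window (Lemma 2.2's core) -/

/-- `η ∈ ℂ[U, U⁻¹]`, `U(u) = u^{iπ/log λ}` (Lemma 2.2, p0006:L83): in the additive variable on the window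
`[−a, a]`, `a = log λ`, `U^k = (2a)^{1/2} χ_k` (Yoshida's exponentials), so the Laurent polynomials are the
elements of the finite trigonometric sections `E_N = Yoshida1992.W a N` (Cor. 2.4; Lemma 2.6), `N ≥ 0`.
[cite: ConnesConsani2023, Lemma 2.2 p. 104 and Cor. 2.4 p. 106 (arXiv chunk p0006:L83, p0007:L82)] -/
def IsLaurentPolynomial (a : ℝ) (η : ℝ → ℂ) : Prop :=
  ∃ N : ℕ, η ∈ Yoshida1992.W a N

/-- The finite sections increase: `E_N ⊆ E_M` for `N ≤ M`. [cite: ConnesConsani2023, Cor. 2.4 (the spans E_N of U^k, |k| ≤ N, increase with N; arXiv chunk p0007:L82)] -/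
theorem W_mono (a : ℝ) {N M : ℕ} (h : N ≤ M) : Yoshida1992.W a N ≤ Yoshida1992.W a M := by
  refine Submodule.span_le.2 ?_
  rintro _ ⟨⟨n, hn⟩, rfl⟩
  refine Submodule.subset_span ⟨⟨n, ?_⟩, rfl⟩
  rw [Yoshida1992.mem_modes] at hn ⊢
  exact hn.trans (by exact_mod_cast h)

/-- Elements of a finite section are Laurent polynomials. [cite: ConnesConsani2023, Lemma 2.2 (ℂ[U,U⁻¹] = ⋃_N E_N; arXiv chunk p0006:L83)] -/
theorem isLaurentPolynomial_of_mem_W {a : ℝ} {N : ℕ} {η : ℝ → ℂ} (h : η ∈ Yoshida1992.W a N) :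
    IsLaurentPolynomial a η :=
  ⟨N, h⟩

/-- `ℂ[U, U⁻¹]` is closed under addition (take the larger section). [cite: ConnesConsani2023, Lemma 2.2 (ℂ[U,U⁻¹] is a linear space; arXiv chunk p0006:L83)] -/
theorem IsLaurentPolynomial.add {a : ℝ} {η θ : ℝ → ℂ} (hη : IsLaurentPolynomial a η)
    (hθ : IsLaurentPolynomial a θ) : IsLaurentPolynomial a (η + θ) := by
  obtain ⟨N, hN⟩ := hη
  obtain ⟨M, hM⟩ := hθ
  exact ⟨max N M, Submodule.add_mem _ (W_mono a (le_max_left N M) hN) (W_mono a (le_max_right N M) hM)⟩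

/-- `ℂ[U, U⁻¹]` is closed under scalars. [cite: ConnesConsani2023, Lemma 2.2 (ℂ[U,U⁻¹] is a linear space; arXiv chunk p0006:L83)] -/
theorem IsLaurentPolynomial.smul {a : ℝ} {η : ℝ → ℂ} (hη : IsLaurentPolynomial a η) (c : ℂ) :
    IsLaurentPolynomial a (c • η) := by
  obtain ⟨N, hN⟩ := hη
  exact ⟨N, Submodule.smul_mem _ c hN⟩

/-! ## §2 The `L²`-extension of `QW_λ` (the object of Prop. 2.1) -/

/-- The squared weighted norm `‖ξ̂‖₁² = ∫ |ξ̂(s)|² (1 + log(1 + s²)) ds` of the proof of Lemma 2.2 (unnumbered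
display p0007:L43; it is the norm of the "equivalent condition" (2.16) = `quadratsemi3`, p0007:L24),
with `ξ̂(s) = weilMellin ξ (1/2 + sI)`; typed as a Lebesgue `lintegral` in `ℝ≥0∞`, so that it is `∞`
exactly when the weighted integral diverges (no junk value). [cite: ConnesConsani2023, proof of Lemma 2.2, eq. (2.16) and the norm ‖·‖₁, p. 105 (arXiv chunk p0007:L24, L43)] -/
def logSobolevEnergy (ξ : ℝ → ℂ) : ℝ≥0∞ :=
  ∫⁻ s : ℝ, ENNReal.ofReal (‖weilMellin ξ (1 / 2 + s * I)‖ ^ 2 * (1 + Real.log (1 + s ^ 2)))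

/-- The FORM DOMAIN of `QW_λ` on the window `[−a, a]` (`a = log λ`): square-integrable `ξ` vanishing off
the window with `‖ξ̂‖₁ < ∞`.  In print: "given `ξ ∈ L²([λ⁻¹,λ], d*u)` such that `Q_∞(ξ,ξ) < ∞`" (p0007:L3),
and `Q_∞(ξ) < ∞ ⇔ ‖ξ̂‖₁ < ∞` by `∂_tθ(t) = ½(log|t| − log 2 − log π) − 1/(48t²) + O(t⁻⁴)` (p0007:L19), all
other terms of (2.11) being bounded (p0006:L85). [cite: ConnesConsani2023, proof of Lemma 2.2, pp. 104–105 (arXiv chunk p0007:L3–L25)] -/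
def formDomain (a : ℝ) : Set (ℝ → ℂ) :=
  {ξ | MemLp ξ 2 volume ∧ Function.support ξ ⊆ Icc (-a) a ∧ logSobolevEnergy ξ < ∞}

/-- The integers whose von Mangoldt terms enter `QW_λ`: `1 < n ≤ λ² = e^{2a}` (Prop. 2.1 (2.11),
`Σ_{1<n≤λ²} Λ(n)⟨f|V(n)f⟩`, p0006:L59), i.e. `N = ⌊e^{2a}⌋` in the tree's `weilFinitePrimeQuadratic N`.
[cite: ConnesConsani2023, Prop. 2.1 eq. (2.11) (arXiv chunk p0006:L57–L60; p. 103)] -/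
def primeCutoff (a : ℝ) : ℕ :=
  ⌊Real.exp (2 * a)⌋₊

open scoped Classical in
/-- RH-FREE · DEFINITION — **The semi-local Weil quadratic form `QW_λ : L²([λ⁻¹, λ], d*u) → (−∞, +∞]`** of Prop. 2.1 (p0006:L55;
p. 103), in the additive variable on `[−a, a]`, `a = log λ`: on the form domain it is the finite-prime
analytic form `E_{⌊λ²⌋}(ξ) = 2 Re(ξ̂(0) conj ξ̂(1)) − (log π)‖ξ‖₂² + (1/2π)∫|ξ̂(1/2+it)|²(Re ψ(1/4+it/2) − ρ(t)) dt`
(`weilFinitePrimeQuadratic`, which is `QW_λ` on test functions by the PROVED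
`weilQuadratic_eq_weilFinitePrimeQuadratic` — see `semilocalWeilForm_eq_re_weilQuadratic`), and `⊤ = +∞`
off it.  Meant for `ξ ∈ L²` supported in the window (values on other functions are not used).
[cite: ConnesConsani2023, Prop. 2.1 (arXiv chunk p0006:L55; p. 103)] -/
def semilocalWeilForm (a : ℝ) (ξ : ℝ → ℂ) : EReal :=
  if logSobolevEnergy ξ < ∞ then ((weilFinitePrimeQuadratic (primeCutoff a) ξ : ℝ) : EReal) else ⊤

/-- On functions of finite energy the extended form is the (real) finite-prime analytic form. [cite: ConnesConsani2023, Prop. 2.1 eq. (2.11) (arXiv chunk p0006:L55–L60; p. 103)] -/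
theorem semilocalWeilForm_of_lt_top {a : ℝ} {ξ : ℝ → ℂ} (h : logSobolevEnergy ξ < ∞) :
    semilocalWeilForm a ξ = ((weilFinitePrimeQuadratic (primeCutoff a) ξ : ℝ) : EReal) := by
  simp [semilocalWeilForm, h]

/-- Off the form domain the extended form is `+∞`. [cite: ConnesConsani2023, Prop. 2.1 (values in (−∞, +∞]; arXiv chunk p0006:L55)] -/
theorem semilocalWeilForm_of_not_lt_top {a : ℝ} {ξ : ℝ → ℂ} (h : ¬ logSobolevEnergy ξ < ∞) :
    semilocalWeilForm a ξ = ⊤ := by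
  simp [semilocalWeilForm, h]

/-- On the form domain the extended form is finite and equal to `E_{⌊λ²⌋}(ξ)`. [cite: ConnesConsani2023, Prop. 2.1 eq. (2.11) (arXiv chunk p0006:L55–L60; p. 103)] -/
theorem semilocalWeilForm_of_mem_formDomain {a : ℝ} {ξ : ℝ → ℂ} (h : ξ ∈ formDomain a) :
    semilocalWeilForm a ξ = ((weilFinitePrimeQuadratic (primeCutoff a) ξ : ℝ) : EReal) :=
  semilocalWeilForm_of_lt_top h.2.2

/-- RH-FREE · FACT — **Prop. 2.1, the `L²`-extension clause** (p0006:L55; p. 103): "the following formula defines a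
LOWER BOUNDED LOWER SEMI-CONTINUOUS quadratic form `QW_λ : L²([λ⁻¹,λ], d*u) → (−∞, +∞]`" — in the sense
fixed on p0006:L30–L36: `q(ξ) ≥ −c‖ξ‖²` for all `ξ`, and `ξ_n → ξ ⇒ q(ξ) ≤ liminf q(ξ_n)`.  Typed for the
window `[−a, a]`, every `a > 0` (`λ = e^a > 1`), on `L²` functions supported in the window, convergence in
`L²`.  (The formula (2.11) itself is the proved `weilQuadratic_eq_weilFinitePrimeQuadratic`; lower
boundedness ON TEST FUNCTIONS is the proved `bddBelow_weilQuadratic_sphere_holds`; what is recorded here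
is the statement on all of `L²`, RH-FREE functional analysis.)  DISCHARGED: `prop_2_1_holds` in
`ZetaCyclesSemilocalFormProofs.lean`. [cite: ConnesConsani2023, Prop. 2.1 (arXiv chunk p0006:L55; p. 103)] -/
def prop_2_1 : Prop :=
  ∀ a : ℝ, 0 < a →
    (∃ c : ℝ, ∀ ξ : ℝ → ℂ, MemLp ξ 2 volume → Function.support ξ ⊆ Icc (-a) a →
        ((-(c * ∫ x, ‖ξ x‖ ^ 2) : ℝ) : EReal) ≤ semilocalWeilForm a ξ) ∧
    (∀ (ξ : ℝ → ℂ) (u : ℕ → ℝ → ℂ), MemLp ξ 2 volume → Function.support ξ ⊆ Icc (-a) a →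
        (∀ n, MemLp (u n) 2 volume ∧ Function.support (u n) ⊆ Icc (-a) a) →
        Tendsto (fun n ↦ ∫ x, ‖u n x - ξ x‖ ^ 2) atTop (𝓝 0) →
        semilocalWeilForm a ξ ≤ liminf (fun n ↦ semilocalWeilForm a (u n)) atTop)

/-! ## §3 Lemma 2.2 (core), Prop. 2.3 (relaxation), Cor. 2.4 (finite sections) — named facts -/

/-- RH-FREE · FACT — **Lemma 2.2** (p0006:L83): "Let `λ > 1`, and `U(u) := u^{iπ/log λ}`. Then the space of Laurent
polynomials `ℂ[U, U⁻¹]` is a core for the quadratic form `QW_λ`."  Typed in the REDUCED FORM to which the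
printed proof reduces it (p0006:L85 and p0007:L3–L25: all terms but `Q_∞` are bounded, and by the asymptotics
of `∂_tθ` the core condition (2.14) "can be replaced by the equivalent condition" (2.16)): for every `ξ` in the form
domain of the window `[−a, a]` (`a = log λ > 0`) and every `ε > 0` there is a Laurent polynomial `η ∈ E_N`
(some `N`) with `∫ |ξ̂(s) − η̂(s)|² (1 + log(1 + s²)) ds < ε`.  RH-FREE (weighted trigonometric
approximation). [cite: ConnesConsani2023, Lemma 2.2 p. 104 with eq. (2.16) of its proof p. 105 (arXiv chunk p0006:L83, p0007:L24)] -/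
def lemma_2_2 : Prop :=
  ∀ a : ℝ, 0 < a → ∀ ξ : ℝ → ℂ, ξ ∈ formDomain a → ∀ ε : ℝ, 0 < ε →
    ∃ N : ℕ, ∃ η ∈ Yoshida1992.W a N, logSobolevEnergy (ξ - η) < ENNReal.ofReal ε

/-- RH-FREE · FACT — **Prop. 2.3** (p0007:L74): "Let `λ > 1`. The quadratic form `QW_λ : L²([λ⁻¹,λ], d*u) → (−∞,+∞]`
of (2.11) fulfills, for any `f ∈ L²([λ⁻¹,λ], d*u)`, `QW_λ(f) = liminf_{g_n → f} QW_λ(g_n)`,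
`g_n ∈ ℂ[U, U⁻¹]`" (eq. (2.20)) — `QW_λ` is the lower semicontinuous envelope of its restriction to the Laurent
polynomials.  Typed as the two clauses of this equality (printed proof, p0007:L80: "the lhs is smaller
than the rhs" by lower semicontinuity, and a sequence with `QW_λ(f) = lim QW_λ(g_n)` exists by Lemma 2.2):
for every window-supported `ξ ∈ L²` (window `[−a, a]`, `a = log λ > 0`), (i) along EVERY sequence of
Laurent polynomials converging to `ξ` in `L²`, `QW_λ(ξ) ≤ liminf QW_λ(η_n)`; (ii) SOME such sequence has
`QW_λ(η_n) → QW_λ(ξ)` (in `(−∞, +∞]`; `→ +∞` when `ξ` is outside the form domain). RH-FREE.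
[cite: ConnesConsani2023, Prop. 2.3 eq. (2.20), p. 106 (arXiv chunk p0007:L74–L80)] -/
def prop_2_3 : Prop :=
  ∀ a : ℝ, 0 < a → ∀ ξ : ℝ → ℂ, MemLp ξ 2 volume → Function.support ξ ⊆ Icc (-a) a →
    (∀ η : ℕ → ℝ → ℂ, (∀ n, IsLaurentPolynomial a (η n)) →
        Tendsto (fun n ↦ ∫ x, ‖η n x - ξ x‖ ^ 2) atTop (𝓝 0) →
        semilocalWeilForm a ξ ≤ liminf (fun n ↦ semilocalWeilForm a (η n)) atTop) ∧
    (∃ η : ℕ → ℝ → ℂ, (∀ n, IsLaurentPolynomial a (η n)) ∧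
        Tendsto (fun n ↦ ∫ x, ‖η n x - ξ x‖ ^ 2) atTop (𝓝 0) ∧
        Tendsto (fun n ↦ semilocalWeilForm a (η n)) atTop (𝓝 (semilocalWeilForm a ξ)))

/-- The SMALLEST EIGENVALUE of the restriction of `QW_λ` to the finite section `E_N` (Cor. 2.4, p0007:L82;
the quantity computed numerically in §2.2–§2.5 for the blocks `σ^±`): the minimum of the (Hermitian,
finite-dimensional) form on the `L²`-unit sphere of `E_N = Yoshida1992.W a N`, written as a real `sInf`
(attained; for `a ≤ 0` the sphere is empty and the value is the junk `sInf ∅`). [cite: ConnesConsani2023, Cor. 2.4 p. 106 (arXiv chunk p0007:L82)] -/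
def finiteSectionMin (a : ℝ) (N : ℕ) : ℝ :=
  sInf {x : ℝ | ∃ η ∈ Yoshida1992.W a N, ∫ t, ‖η t‖ ^ 2 = (1 : ℝ) ∧
    x = weilFinitePrimeQuadratic (primeCutoff a) η}

/-- The LOWER BOUND of `QW_λ` (Cor. 2.4, p0007:L82; "an inequality of the form `q(ξ) ≥ −c‖ξ‖²` …
reflecting the lower bound of `q`", p0006:L36): the infimum of the form over the `L²`-unit sphere of its
form domain on the window `[−a, a]` — the bottom of the spectrum of the associated self-adjoint operator
(p0006:L46).  (On the unit sphere of TEST functions the infimum is the tree's `weilGroundEnergy a`; the two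
agree because `C_c^∞((−a, a))` is also a form core, which is the middle step (2.15)–(2.16) of the printed
proof of Lemma 2.2 — not asserted here.) [cite: ConnesConsani2023, Cor. 2.4 p. 106 (arXiv chunk p0007:L82) with p0006:L36 (p. 102)] -/
def formLowerBound (a : ℝ) : ℝ :=
  sInf {x : ℝ | ∃ ξ ∈ formDomain a, ∫ t, ‖ξ t‖ ^ 2 = (1 : ℝ) ∧
    x = weilFinitePrimeQuadratic (primeCutoff a) ξ}

/-- RH-FREE · FACT — **Cor. 2.4** (p0007:L82): "The lower bound of `QW_λ` is the limit, when `N → ∞`, of the smallest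
eigenvalue of the restriction of `QW_λ` to the linear span `E_N` of the functions `U^k` for `|k| ≤ N`."
Window `[−a, a]`, `a = log λ > 0`.  RH-FREE (a statement about Ritz–Galerkin approximation of the bottom of
a closed form on a core; no sign is asserted). [cite: ConnesConsani2023, Cor. 2.4 p. 106 (arXiv chunk p0007:L82)] -/
def cor_2_4 : Prop :=
  ∀ a : ℝ, 0 < a → Tendsto (fun N : ℕ ↦ finiteSectionMin a N) atTop (𝓝 (formLowerBound a))

/-! ## §4 Proved glue: test functions, the domain, and the tree's `weilQuadratic` -/

/-- The log weight is dominated quadratically: `|1 + log(1 + s²)| ≤ 1 + s²`. [cite: ConnesConsani2023, proof of Lemma 2.2, elementary weight bounds of the same kind as log(1+(s−a)²) ≤ log 2 + log(1+s²) + log(1+a²) (arXiv chunk p0007:L65)] -/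
theorem abs_one_add_log_one_add_sq_le (s : ℝ) : |1 + Real.log (1 + s ^ 2)| ≤ 1 + 1 * s ^ 2 := by
  have h0 : 0 ≤ Real.log (1 + s ^ 2) := Real.log_nonneg (by nlinarith [sq_nonneg s])
  have h1 : Real.log (1 + s ^ 2) ≤ s ^ 2 := by
    have := Real.log_le_sub_one_of_pos (show 0 < 1 + s ^ 2 by positivity)
    linarith
  rw [abs_of_nonneg (by linarith)]
  linarith

/-- For a test function the weighted integrand `|ĝ(1/2+is)|²(1 + log(1+s²))` is integrable
(`‖ĝ(1/2+is)‖ = O((1+s²)⁻¹)`, `integrable_norm_sq_weilMellin_mul`). [cite: ConnesConsani2023, proof of Lemma 2.2, ∫|ξ̂(s)|²(1+log(1+s²))ds < ∞ (arXiv chunk p0007:L37)] -/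
theorem integrable_norm_sq_weilMellin_mul_logWeight {g : ℝ → ℂ} (hg : IsWeilTest g) :
    Integrable fun s : ℝ ↦ ‖weilMellin g (1 / 2 + s * I)‖ ^ 2 * (1 + Real.log (1 + s ^ 2)) := by
  refine integrable_norm_sq_weilMellin_mul hg ?_ zero_le_one zero_le_one abs_one_add_log_one_add_sq_le
  exact (measurable_const.add ((measurable_const.add (measurable_id.pow_const 2)).log))

/-- Test functions have finite energy `‖ĝ‖₁ < ∞`. [cite: ConnesConsani2023, proof of Lemma 2.2, ∫|ξ̂(s)|²(1+log(1+s²))ds < ∞ (arXiv chunk p0007:L37)] -/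
theorem logSobolevEnergy_lt_top_of_isWeilTest {g : ℝ → ℂ} (hg : IsWeilTest g) :
    logSobolevEnergy g < ∞ := by
  unfold logSobolevEnergy
  exact (integrable_norm_sq_weilMellin_mul_logWeight hg).lintegral_lt_top

/-- **Test functions on the window belong to the form domain** (`C(a) ⊆ Dom(QW_λ)`; p0006:L68 "the domain
… is dense since it contains all smooth functions with support in `(λ⁻¹, λ)`"). [cite: ConnesConsani2023, proof of Prop. 2.1 (arXiv chunk p0006:L68)] -/
theorem mem_formDomain_of_isWeilTest {a : ℝ} {g : ℝ → ℂ} (hg : IsWeilTest g)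
    (hsupp : tsupport g ⊆ Icc (-a) a) : g ∈ formDomain a :=
  ⟨hg.1.continuous.memLp_of_hasCompactSupport hg.2,
    (subset_tsupport g).trans hsupp, logSobolevEnergy_lt_top_of_isWeilTest hg⟩

/-- The window `[−a, a]` lies inside the finite-prime cone of `N = ⌊e^{2a}⌋`:
`a ≤ (log (N + 1))/2`. [cite: ConnesConsani2023, Prop. 2.1 eq. (2.11), the range 1 < n ≤ λ² (arXiv chunk p0006:L59)] -/
theorem le_log_primeCutoff_add_one_div_two (a : ℝ) :
    a ≤ Real.log ((primeCutoff a : ℝ) + 1) / 2 := by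
  have h : Real.exp (2 * a) ≤ (primeCutoff a : ℝ) + 1 :=
    (Nat.lt_floor_add_one (Real.exp (2 * a))).le
  have h2 : 2 * a ≤ Real.log ((primeCutoff a : ℝ) + 1) := by
    rw [← Real.log_exp (2 * a)]
    exact Real.log_le_log (Real.exp_pos _) h
  linarith

/-- **On test functions the extended form IS the tree's Weil quadratic form**: for `g ∈ C_c^∞` with
`tsupport g ⊆ [−a, a]`, `semilocalWeilForm a g = Re Q(g)` (`Q = weilQuadratic`; via the proved
`weilQuadratic_eq_weilFinitePrimeQuadratic`, Prop. 2.1's formula). [cite: ConnesConsani2023, Prop. 2.1 (arXiv chunk p0006:L55; p. 103)] -/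
theorem semilocalWeilForm_eq_re_weilQuadratic {a : ℝ} {g : ℝ → ℂ} (hg : IsWeilTest g)
    (hsupp : tsupport g ⊆ Icc (-a) a) :
    semilocalWeilForm a g = (((weilQuadratic g).re : ℝ) : EReal) := by
  rw [semilocalWeilForm_of_lt_top (logSobolevEnergy_lt_top_of_isWeilTest hg)]
  have hs : tsupport g ⊆ Icc (-(Real.log ((primeCutoff a : ℝ) + 1) / 2))
      (Real.log ((primeCutoff a : ℝ) + 1) / 2) :=
    hsupp.trans (Icc_subset_Icc (neg_le_neg (le_log_primeCutoff_add_one_div_two a))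
      (le_log_primeCutoff_add_one_div_two a))
  rw [weilQuadratic_eq_weilFinitePrimeQuadratic hg (primeCutoff a) hs, Complex.ofReal_re]

/-- The lower bound of the form is at most its value at any unit vector of the domain (when the set of
values is bounded below, e.g. under `prop_2_1`). [cite: ConnesConsani2023, Cor. 2.4 with p0006:L36 (the lower bound of QW_λ; arXiv chunk p0007:L82)] -/
theorem formLowerBound_le {a : ℝ} {ξ : ℝ → ℂ} (hξ : ξ ∈ formDomain a)
    (hnorm : ∫ t, ‖ξ t‖ ^ 2 = (1 : ℝ))
    (hbdd : BddBelow {x : ℝ | ∃ ξ ∈ formDomain a, ∫ t, ‖ξ t‖ ^ 2 = (1 : ℝ) ∧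
      x = weilFinitePrimeQuadratic (primeCutoff a) ξ}) :
    formLowerBound a ≤ weilFinitePrimeQuadratic (primeCutoff a) ξ :=
  csInf_le hbdd ⟨ξ, hξ, hnorm, rfl⟩

/-! ## §5 The prolate vectors and the prolate projection `Π(λ, k)` (Def. 3.1) -/

/-- The combinations `φ_n` of prolate functions vanishing at `0` (p0012:L7–L11): for `n = 2m`,
`φ_{2m} = ψ_{2m} ψ_0(0) − ψ_0 ψ_{2m}(0)`, for `n = 2m+1`, `φ_{2m+1} = ψ_{2m+1} ψ_1(0) − ψ_1 ψ_{2m+1}(0)`,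
i.e. `φ_n = ψ_n ψ_{n mod 2}(0) − ψ_{n mod 2} ψ_n(0)`.  Here `ψ : ℕ → ℝ → ℝ` is the family
`ψ_j = ψ_{j,λ} = PS_{2j,0}(2πλ², x/λ)` (p0011:L33), in the tree `IsProlateFunction lam (2*j) (ψ j)` (the
normalisation only rescales `φ_n`).  For `n < 2` the formula gives `0`; Def. 3.1 uses `n ≥ 2`.
[cite: ConnesConsani2023, §3 display before eq. (3.4), p. 120 (arXiv chunk p0012:L11)] -/
def prolatePhi (ψ : ℕ → ℝ → ℝ) (n : ℕ) (x : ℝ) : ℝ :=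
  ψ n x * ψ (n % 2) 0 - ψ (n % 2) x * ψ n 0

/-- `φ_n(0) = 0` ("linear combinations of prolate functions which vanish at `0`", p0012:L8). [cite: ConnesConsani2023, §3 (arXiv chunk p0012:L7–L8)] -/
theorem prolatePhi_apply_zero (ψ : ℕ → ℝ → ℝ) (n : ℕ) : prolatePhi ψ n 0 = 0 := by
  unfold prolatePhi
  ring

/-- For `n < 2` the combination is trivial (`n mod 2 = n`). [cite: ConnesConsani2023, §3, φ_n defined for n ≥ 2 (arXiv chunk p0012:L8–L11)] -/
theorem prolatePhi_of_lt_two (ψ : ℕ → ℝ → ℝ) {n : ℕ} (hn : n < 2) : prolatePhi ψ n = 0 := by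
  funext x
  have : n % 2 = n := Nat.mod_eq_of_lt hn
  simp only [prolatePhi, this, Pi.zero_apply]
  ring

/-- RH-FREE · DEFINITION — the **prolate vector** `v_n ∈ L²([−a, a])` (`a = log λ`), the function whose components on the basis
`η_j` are the printed (3.4) `𝓔(φ_n)_j ≃ 2 Σ_{1≤r<λ} ∫_1^{λ/r} u^{1/2} φ_n(ru) η_j(u) d*u` (p0012:L20): on
`1 ≤ u ≤ λ` it is `𝓔(φ_n)(u) = u^{1/2} Σ_r φ_n(ru)` (`connesE`), and it is extended to `λ⁻¹ ≤ u < 1` by the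
parity rule "act as if `𝓔(φ_n)(u⁻¹) = (−1)^n 𝓔(φ_n)(u)`" (p0012:L14–L16).  Additively: `v_n(x) = 𝓔(φ_n)(e^{|x|})`
times `1` (even `n`) or `sign x` (odd `n`) for `|x| ≤ a`, and `0` for `|x| > a`.
[cite: ConnesConsani2023, §3 eq. (3.4) p. 120 (arXiv chunk p0012:L14–L21)] -/
def prolateVector (a : ℝ) (ψ : ℕ → ℝ → ℝ) (n : ℕ) (x : ℝ) : ℂ :=
  if |x| ≤ a then
    (((if Even n then (1 : ℝ) else Real.sign x) * connesE (prolatePhi ψ n) (Real.exp |x|) : ℝ) : ℂ)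
  else 0

/-- The prolate vector vanishes off the window. [cite: ConnesConsani2023, §3 (functions on [λ⁻¹, λ]; arXiv chunk p0012:L18)] -/
theorem prolateVector_eq_zero {a : ℝ} (ψ : ℕ → ℝ → ℝ) (n : ℕ) {x : ℝ} (hx : a < |x|) :
    prolateVector a ψ n x = 0 := by
  simp [prolateVector, not_le.2 hx]

/-- **Parity of the prolate vectors** (the grading `γ`, p0012:L28: "`γ` takes the values `±1` on functions
satisfying `f(u⁻¹) = ±f(u)` … the vectors `ε_n` are eigenvectors of `γ`"): `v_n(−x) = (−1)^n v_n(x)`.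
This is the content of (3.5) `γ Π(λ,k) = Π(λ,k) γ` at the level of the spanning vectors. [cite: ConnesConsani2023, §3 eq. (3.5) p. 121 (arXiv chunk p0012:L28–L31)] -/
theorem prolateVector_neg (a : ℝ) (ψ : ℕ → ℝ → ℝ) (n : ℕ) (x : ℝ) :
    prolateVector a ψ n (-x) = (-1) ^ n * prolateVector a ψ n x := by
  unfold prolateVector
  rw [abs_neg]
  by_cases hx : |x| ≤ a
  · rcases Nat.even_or_odd n with hn | hn
    · simp only [if_pos hx, if_pos hn, hn.neg_one_pow, one_mul]
    · simp only [if_pos hx, if_neg (Nat.not_even_iff_odd.2 hn), hn.neg_one_pow, Real.sign_neg,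
        neg_mul, Complex.ofReal_neg, one_mul]
  · simp only [if_neg hx, mul_zero]

/-- The truncation of the prolate vector to the finite section `E_N`: its Fourier series in the `χ_j`,
`|j| ≤ N` ("One computes all these components for `|j| ≤ N` with `N` large … the obtained vectors in
`E_N`", p0012:L24; `Yoshida1992.proj`). [cite: ConnesConsani2023, §3 (arXiv chunk p0012:L24)] -/
def prolateVectorN (a : ℝ) (ψ : ℕ → ℝ → ℝ) (N n : ℕ) : ℝ → ℂ :=
  Yoshida1992.proj a N (prolateVector a ψ n)

/-- The truncated prolate vectors lie in `E_N`. [cite: ConnesConsani2023, §3 ("orthonormal vectors ε_n ∈ E_N"; arXiv chunk p0012:L24)] -/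
theorem prolateVectorN_mem_W (a : ℝ) (ψ : ℕ → ℝ → ℝ) (N n : ℕ) :
    prolateVectorN a ψ N n ∈ Yoshida1992.W a N :=
  Yoshida1992.proj_mem_W a N _

/-- The RANGE of `Π(λ, k)`: the linear span of the (truncated) prolate vectors `v_n`, `n ∈ {2, …, k+1}`
(Def. 3.1, p0012:L26; Gram–Schmidt orthonormalisation "separately for the even and odd cases"
(p0012:L24) does not change this span, the two parity classes being orthogonal). [cite: ConnesConsani2023, Def. 3.1 p. 120 (arXiv chunk p0012:L26)] -/
def prolateSpan (a : ℝ) (ψ : ℕ → ℝ → ℝ) (N k : ℕ) : Submodule ℂ (ℝ → ℂ) :=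
  Submodule.span ℂ (Set.range fun i : Fin k ↦ prolateVectorN a ψ N ((i : ℕ) + 2))

/-- The range of `Π(λ, k)` is a subspace of `E_N` ("`ε_n ∈ E_N ⊂ 𝓗`", p0012:L24). [cite: ConnesConsani2023, §3 (arXiv chunk p0012:L24)] -/
theorem prolateSpan_le_W (a : ℝ) (ψ : ℕ → ℝ → ℝ) (N k : ℕ) :
    prolateSpan a ψ N k ≤ Yoshida1992.W a N := by
  refine Submodule.span_le.2 ?_
  rintro _ ⟨i, rfl⟩
  exact prolateVectorN_mem_W a ψ N _

/-- The `L²` inner product of the window, `⟨f | g⟩ = ∫_{−a}^{a} conj f · g` (antilinear in the first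
variable, as on p0006:L37), i.e. `⟨f|g⟩ = ∫_{λ⁻¹}^{λ} conj f(u) g(u) d*u` multiplicatively. [cite: ConnesConsani2023, §2.1.3 inner product display (arXiv chunk p0007:L86–L88)] -/
def windowInner (a : ℝ) (f g : ℝ → ℂ) : ℂ :=
  ∫ x in Icc (-a) a, conj (f x) * g x

/-- The Gram matrix `G_{ij} = ⟨v_{i+2} | v_{j+2}⟩` of the truncated prolate vectors spanning the range of
`Π(λ, k)` (the input of the printed Gram–Schmidt step, p0012:L24). [cite: ConnesConsani2023, §3 (arXiv chunk p0012:L24)] -/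
def prolateGram (a : ℝ) (ψ : ℕ → ℝ → ℝ) (N k : ℕ) : Matrix (Fin k) (Fin k) ℂ :=
  Matrix.of fun i j ↦ windowInner a (prolateVectorN a ψ N ((i : ℕ) + 2)) (prolateVectorN a ψ N ((j : ℕ) + 2))

/-- RH-FREE · DEFINITION — **Def. 3.1 — the prolate projection `Π(λ, k)`** (p0012:L26): "Let `k < ν(λ²)`. We define `Π(λ, k)` as the
orthogonal projection on the linear span of the vectors `ε_n`, for `n ∈ {2, …, k+1}`", where the `ε_n ∈ E_N`
are the Gram–Schmidt orthonormalisation of the truncated prolate vectors (p0012:L24).  Written without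
Gram–Schmidt, by the Gram-matrix formula `Π f = Σ_{i,j} (G⁻¹)_{ij} ⟨v_{j+2} | f⟩ v_{i+2}` for the orthogonal
projection onto `span{v_2, …, v_{k+1}} = span{ε_2, …, ε_{k+1}}`; this IS that projection when the `v_n` are
linearly independent (the situation in print, where Gram–Schmidt is performed), and a junk linear map into
the span otherwise (`Matrix.inv` of a singular matrix is `0`).  Parameters: window `a = log λ`, prolate
family `ψ` (`IsProlateFunction lam (2*j) (ψ j)`), truncation order `N` of the Fourier basis, rank `k`; the
printed proviso `k < ν(λ²) ≈ 2λ²` (p0012:L1–L4) delimits the regime where the construction is meaningful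
and is not part of the definition. [cite: ConnesConsani2023, Def. 3.1 p. 120 (arXiv chunk p0012:L26)] -/
def prolateProjection (a : ℝ) (ψ : ℕ → ℝ → ℝ) (N k : ℕ) (f : ℝ → ℂ) : ℝ → ℂ :=
  ∑ i : Fin k, (∑ j : Fin k, (prolateGram a ψ N k)⁻¹ i j *
    windowInner a (prolateVectorN a ψ N ((j : ℕ) + 2)) f) • prolateVectorN a ψ N ((i : ℕ) + 2)

/-- `Π(λ, k) f` lies in the span of the prolate vectors (so `Π(λ,k)` has rank `≤ k` and range in `E_N`).
[cite: ConnesConsani2023, Def. 3.1 (arXiv chunk p0012:L26)] -/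
theorem prolateProjection_mem_prolateSpan (a : ℝ) (ψ : ℕ → ℝ → ℝ) (N k : ℕ) (f : ℝ → ℂ) :
    prolateProjection a ψ N k f ∈ prolateSpan a ψ N k :=
  Submodule.sum_mem _ fun i _ ↦ Submodule.smul_mem _ _ (Submodule.subset_span ⟨i, rfl⟩)

/-- `Π(λ, k)` is additive in `f` (it is a finite sum of rank-one maps `f ↦ ⟨v|f⟩ w`), on functions for
which the window pairings converge. [cite: ConnesConsani2023, Def. 3.1 (Π(λ,k) is a linear projection; arXiv chunk p0012:L26)] -/
theorem prolateProjection_add (a : ℝ) (ψ : ℕ → ℝ → ℝ) (N k : ℕ) {f g : ℝ → ℂ}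
    (hf : ∀ j : Fin k, IntegrableOn
      (fun x ↦ conj (prolateVectorN a ψ N ((j : ℕ) + 2) x) * f x) (Icc (-a) a))
    (hg : ∀ j : Fin k, IntegrableOn
      (fun x ↦ conj (prolateVectorN a ψ N ((j : ℕ) + 2) x) * g x) (Icc (-a) a)) :
    prolateProjection a ψ N k (f + g) = prolateProjection a ψ N k f + prolateProjection a ψ N k g := by
  unfold prolateProjection
  rw [← Finset.sum_add_distrib]
  refine Finset.sum_congr rfl fun i _ ↦ ?_
  rw [← add_smul, ← Finset.sum_add_distrib]
  congr 1
  refine Finset.sum_congr rfl fun j _ ↦ ?_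
  rw [← mul_add]
  congr 1
  unfold windowInner
  rw [← integral_add (hf j) (hg j)]
  congr 1 with x
  simp [mul_add]

/-! ## §6 Eq. (3.5) `γ Π(λ,k) = Π(λ,k) γ` at operator level (proved) -/

/-- Membership in the symmetric window is invariant under `x ↦ −x`. [folklore] -/
private theorem neg_mem_Icc_iff (a x : ℝ) : -x ∈ Icc (-a) a ↔ x ∈ Icc (-a) a := by
  simp only [mem_Icc]
  constructor <;> rintro ⟨h1, h2⟩ <;> constructor <;> linarith

/-- `χ_n(−x) = χ_{−n}(x)` for Yoshida's exponentials. [cite: ConnesConsani2023, §3 eq. (3.5) (the grading γ on E_N; arXiv chunk p0012:L28–L31)] -/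
theorem chi_apply_neg (a : ℝ) (n : ℤ) (x : ℝ) :
    Yoshida1992.chi a n (-x) = Yoshida1992.chi a (-n) x := by
  unfold Yoshida1992.chi Yoshida1992.chiCore
  by_cases hx : x ∈ Icc (-a) a
  · rw [indicator_of_mem ((neg_mem_Icc_iff a x).2 hx), indicator_of_mem hx]
    congr 2
    push_cast
    ring
  · rw [indicator_of_notMem (mt (neg_mem_Icc_iff a x).1 hx), indicator_of_notMem hx]

/-- `ĉ_n(φ ∘ neg) = ĉ_{−n}(φ)` for the window Fourier coefficients. [cite: ConnesConsani2023, §3 eq. (3.5) (the grading γ on E_N; arXiv chunk p0012:L28–L31)] -/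
theorem fourierCoeff_comp_neg (a : ℝ) (n : ℤ) (φ : ℝ → ℂ) :
    Yoshida1992.fourierCoeff a n (fun x ↦ φ (-x)) = Yoshida1992.fourierCoeff a (-n) φ := by
  unfold Yoshida1992.fourierCoeff
  set F : ℝ → ℂ := fun y ↦ φ y * cexp (π * I * n * y / a) with hF
  have h1 : ∀ x : ℝ, (fun x ↦ φ (-x)) x * cexp (-(π * I * n * x / a)) = F (-x) := by
    intro x
    simp only [hF]
    congr 1
    push_cast
    ring_nf
  simp_rw [h1]
  rw [intervalIntegral.integral_comp_neg (f := F)]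
  simp only [neg_neg]
  refine intervalIntegral.integral_congr fun x _ ↦ ?_
  simp only [hF]
  congr 1
  push_cast
  ring_nf

/-- The truncated Fourier series is homogeneous. [cite: ConnesConsani2023, §3 (components in E_N; arXiv chunk p0012:L24)] -/
theorem proj_smul (a : ℝ) (N : ℕ) (c : ℂ) (φ : ℝ → ℂ) :
    Yoshida1992.proj a N (c • φ) = c • Yoshida1992.proj a N φ := by
  unfold Yoshida1992.proj
  rw [Finset.smul_sum]
  refine Finset.sum_congr rfl fun n _ ↦ ?_
  rw [Yoshida1992.fourierCoeff_smul, smul_smul]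
  congr 1
  ring

/-- The truncated Fourier series commutes with the reflection `x ↦ −x` (`γ` preserves `E_N`).
[cite: ConnesConsani2023, §3 eq. (3.5) (the grading γ on E_N; arXiv chunk p0012:L28–L31)] -/
theorem proj_comp_neg (a : ℝ) (N : ℕ) (φ : ℝ → ℂ) :
    Yoshida1992.proj a N (fun x ↦ φ (-x)) = fun x ↦ Yoshida1992.proj a N φ (-x) := by
  funext x
  simp only [Yoshida1992.proj, Finset.sum_apply, Pi.smul_apply, smul_eq_mul, fourierCoeff_comp_neg,
    chi_apply_neg]
  refine Finset.sum_equiv (Equiv.neg ℤ) (fun n ↦ ?_) (fun n _ ↦ ?_)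
  · simp [Yoshida1992.mem_modes, abs_neg]
  · simp

/-- **Parity of the truncated prolate vectors**: `ε`-generators are eigenvectors of `γ`,
`v_n^{(N)}(−x) = (−1)^n v_n^{(N)}(x)`. [cite: ConnesConsani2023, §3 eq. (3.5) ("the vectors ε_n are eigenvectors of γ"; arXiv chunk p0012:L28–L31)] -/
theorem prolateVectorN_neg (a : ℝ) (ψ : ℕ → ℝ → ℝ) (N n : ℕ) (x : ℝ) :
    prolateVectorN a ψ N n (-x) = (-1) ^ n * prolateVectorN a ψ N n x := by
  have h : (fun y ↦ prolateVector a ψ n (-y)) = ((-1 : ℂ) ^ n) • prolateVector a ψ n := by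
    funext y
    simp [prolateVector_neg]
  have hx := congrFun (proj_comp_neg a N (prolateVector a ψ n)) x
  unfold prolateVectorN
  rw [← hx, h, proj_smul]
  simp

/-- Reflection invariance of the window integral: `∫_{[−a,a]} g(−x) dx = ∫_{[−a,a]} g(x) dx`.
[cite: ConnesConsani2023, §3 eq. (3.5) (γ is unitary on L²([λ⁻¹,λ], d*u); arXiv chunk p0012:L28–L31)] -/
theorem setIntegral_Icc_comp_neg (a : ℝ) (g : ℝ → ℂ) :
    ∫ x in Icc (-a) a, g (-x) = ∫ x in Icc (-a) a, g x := by
  rw [← integral_indicator measurableSet_Icc, ← integral_indicator measurableSet_Icc]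
  have h : (Icc (-a) a).indicator (fun x ↦ g (-x)) = fun x ↦ ((Icc (-a) a).indicator g) (-x) := by
    funext x
    by_cases hx : x ∈ Icc (-a) a
    · rw [indicator_of_mem hx, indicator_of_mem ((neg_mem_Icc_iff a x).2 hx)]
    · rw [indicator_of_notMem hx, indicator_of_notMem (mt (neg_mem_Icc_iff a x).1 hx)]
  rw [h]
  exact integral_neg_eq_self _ volume

/-- `⟨f ∘ neg | g ∘ neg⟩ = ⟨f | g⟩` on the window. [cite: ConnesConsani2023, §3 eq. (3.5) (γ is unitary; arXiv chunk p0012:L28–L31)] -/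
theorem windowInner_comp_neg (a : ℝ) (f g : ℝ → ℂ) :
    windowInner a (fun x ↦ f (-x)) (fun x ↦ g (-x)) = windowInner a f g :=
  setIntegral_Icc_comp_neg a (fun x ↦ conj (f x) * g x)

/-- If `v ∘ neg = s v` with `s` real then `⟨v | f ∘ neg⟩ = s ⟨v | f⟩`. [cite: ConnesConsani2023, §3 eq. (3.5) (arXiv chunk p0012:L28–L31)] -/
theorem windowInner_comp_neg_right (a : ℝ) {v : ℝ → ℂ} {s : ℂ} (hs : conj s = s)
    (hv : ∀ x, v (-x) = s * v x) (f : ℝ → ℂ) :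
    windowInner a v (fun x ↦ f (-x)) = s * windowInner a v f := by
  have h1 : windowInner a v (fun x ↦ f (-x)) = windowInner a (fun x ↦ v (-x)) f := by
    rw [← windowInner_comp_neg a (fun x ↦ v (-x)) f]
    simp only [neg_neg]
  rw [h1]
  unfold windowInner
  simp only [hv, map_mul, hs]
  simp_rw [mul_assoc]
  exact integral_const_mul s _

/-- `S² = 1` for the sign matrix `S = diag((−1)^{i+2})` of the grading `γ` on the generators
`v_{i+2}`. [cite: ConnesConsani2023, §3 eq. (3.5) (γ² = 1; arXiv chunk p0012:L28–L31)] -/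
theorem paritySigns_mul_self (k : ℕ) :
    Matrix.diagonal (fun i : Fin k ↦ (-1 : ℂ) ^ ((i : ℕ) + 2)) *
      Matrix.diagonal (fun i : Fin k ↦ (-1 : ℂ) ^ ((i : ℕ) + 2)) = 1 := by
  rw [Matrix.diagonal_mul_diagonal, ← Matrix.diagonal_one]
  congr 1
  funext i
  rw [← pow_add, ← two_mul]
  exact Even.neg_one_pow ⟨(i : ℕ) + 2, by ring⟩

/-- The Gram matrix is `γ`-invariant: `G = S G S` (entries between generators of opposite parity
vanish). [cite: ConnesConsani2023, §3 eq. (3.5) (Gram–Schmidt "separately for the even and odd cases"; arXiv chunk p0012:L24–L31)] -/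
theorem prolateGram_eq_signs_mul (a : ℝ) (ψ : ℕ → ℝ → ℝ) (N k : ℕ) :
    prolateGram a ψ N k = Matrix.diagonal (fun i : Fin k ↦ (-1 : ℂ) ^ ((i : ℕ) + 2)) *
      prolateGram a ψ N k * Matrix.diagonal (fun i : Fin k ↦ (-1 : ℂ) ^ ((i : ℕ) + 2)) := by
  ext i j
  simp only [Matrix.diagonal_mul, Matrix.mul_diagonal, prolateGram, Matrix.of_apply]
  have hi : ∀ x, prolateVectorN a ψ N ((i : ℕ) + 2) (-x) =
      (-1 : ℂ) ^ ((i : ℕ) + 2) * prolateVectorN a ψ N ((i : ℕ) + 2) x :=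
    prolateVectorN_neg a ψ N _
  have hj : ∀ x, prolateVectorN a ψ N ((j : ℕ) + 2) (-x) =
      (-1 : ℂ) ^ ((j : ℕ) + 2) * prolateVectorN a ψ N ((j : ℕ) + 2) x :=
    prolateVectorN_neg a ψ N _
  conv_lhs => rw [← windowInner_comp_neg a]
  unfold windowInner
  simp only [hi, hj, map_mul, map_pow, map_neg, map_one]
  rw [← integral_const_mul, ← integral_mul_const]
  congr 1 with x
  ring

/-- Hence `G⁻¹ = S G⁻¹ S`. [cite: ConnesConsani2023, §3 eq. (3.5) (arXiv chunk p0012:L28–L31)] -/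
theorem prolateGram_inv_eq_signs_mul (a : ℝ) (ψ : ℕ → ℝ → ℝ) (N k : ℕ) :
    (prolateGram a ψ N k)⁻¹ = Matrix.diagonal (fun i : Fin k ↦ (-1 : ℂ) ^ ((i : ℕ) + 2)) *
      (prolateGram a ψ N k)⁻¹ * Matrix.diagonal (fun i : Fin k ↦ (-1 : ℂ) ^ ((i : ℕ) + 2)) := by
  set S : Matrix (Fin k) (Fin k) ℂ := Matrix.diagonal (fun i : Fin k ↦ (-1 : ℂ) ^ ((i : ℕ) + 2)) with hSdef
  have hS : S⁻¹ = S := Matrix.inv_eq_left_inv (paritySigns_mul_self k)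
  conv_lhs => rw [prolateGram_eq_signs_mul a ψ N k]
  rw [Matrix.mul_inv_rev, Matrix.mul_inv_rev, hS, Matrix.mul_assoc]

/-- Entrywise: `(G⁻¹)_{ij} (−1)^{j+2} = (−1)^{i+2} (G⁻¹)_{ij}`. [cite: ConnesConsani2023, §3 eq. (3.5) (arXiv chunk p0012:L28–L31)] -/
theorem prolateGram_inv_apply_mul_sign (a : ℝ) (ψ : ℕ → ℝ → ℝ) (N k : ℕ) (i j : Fin k) :
    (prolateGram a ψ N k)⁻¹ i j * (-1 : ℂ) ^ ((j : ℕ) + 2) =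
      (-1 : ℂ) ^ ((i : ℕ) + 2) * (prolateGram a ψ N k)⁻¹ i j := by
  have h := congrFun (congrFun (prolateGram_inv_eq_signs_mul a ψ N k) i) j
  simp only [Matrix.diagonal_mul, Matrix.mul_diagonal] at h
  -- h : Ginv i j = (-1)^(i+2) * Ginv i j * (-1)^(j+2)
  have hsq : ((-1 : ℂ) ^ ((j : ℕ) + 2)) * ((-1 : ℂ) ^ ((j : ℕ) + 2)) = 1 := by
    rw [← pow_add, ← two_mul]
    exact Even.neg_one_pow ⟨(j : ℕ) + 2, by ring⟩
  calc (prolateGram a ψ N k)⁻¹ i j * (-1 : ℂ) ^ ((j : ℕ) + 2)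
      = ((-1 : ℂ) ^ ((i : ℕ) + 2) * (prolateGram a ψ N k)⁻¹ i j * (-1 : ℂ) ^ ((j : ℕ) + 2)) *
          (-1 : ℂ) ^ ((j : ℕ) + 2) := by rw [← h]
    _ = (-1 : ℂ) ^ ((i : ℕ) + 2) * (prolateGram a ψ N k)⁻¹ i j *
          (((-1 : ℂ) ^ ((j : ℕ) + 2)) * ((-1 : ℂ) ^ ((j : ℕ) + 2))) := by ring
    _ = (-1 : ℂ) ^ ((i : ℕ) + 2) * (prolateGram a ψ N k)⁻¹ i j := by rw [hsq, mul_one]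

/-- **Eq. (3.5): `γ Π(λ,k) = Π(λ,k) γ`** — the prolate projection commutes with the grading
`(γ f)(u) = f(u⁻¹)`, i.e. `(γ f)(x) = f(−x)` additively, for every `f`, `λ = e^a`, `N`, `k` and every
prolate family `ψ`. [cite: ConnesConsani2023, §3 eq. (3.5) p. 121 (arXiv chunk p0012:L28–L31)] -/
theorem prolateProjection_comp_neg (a : ℝ) (ψ : ℕ → ℝ → ℝ) (N k : ℕ) (f : ℝ → ℂ) :
    prolateProjection a ψ N k (fun x ↦ f (-x)) = fun x ↦ prolateProjection a ψ N k f (-x) := by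
  funext x
  unfold prolateProjection
  rw [Finset.sum_apply, Finset.sum_apply]
  simp only [Pi.smul_apply, smul_eq_mul]
  have hw : ∀ j : Fin k, windowInner a (prolateVectorN a ψ N ((j : ℕ) + 2)) (fun x ↦ f (-x)) =
      (-1 : ℂ) ^ ((j : ℕ) + 2) * windowInner a (prolateVectorN a ψ N ((j : ℕ) + 2)) f :=
    fun j ↦ windowInner_comp_neg_right a (by simp) (prolateVectorN_neg a ψ N _) f
  simp only [hw, prolateVectorN_neg]
  refine Finset.sum_congr rfl fun i _ ↦ ?_
  rw [Finset.sum_mul, Finset.sum_mul]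
  refine Finset.sum_congr rfl fun j _ ↦ ?_
  have hij := prolateGram_inv_apply_mul_sign a ψ N k i j
  calc (prolateGram a ψ N k)⁻¹ i j *
        ((-1 : ℂ) ^ ((j : ℕ) + 2) * windowInner a (prolateVectorN a ψ N ((j : ℕ) + 2)) f) *
        prolateVectorN a ψ N ((i : ℕ) + 2) x
      = ((prolateGram a ψ N k)⁻¹ i j * (-1 : ℂ) ^ ((j : ℕ) + 2)) *
          windowInner a (prolateVectorN a ψ N ((j : ℕ) + 2)) f *
          prolateVectorN a ψ N ((i : ℕ) + 2) x := by ring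
    _ = (prolateGram a ψ N k)⁻¹ i j * windowInner a (prolateVectorN a ψ N ((j : ℕ) + 2)) f *
          ((-1) ^ ((i : ℕ) + 2) * prolateVectorN a ψ N ((i : ℕ) + 2) x) := by rw [hij]; ring

end Literature.NumberTheory.ConnesConsani2023

end
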